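import Mathlib
import Summits.CriticalPhenomena.PercolationContinuityZ3.Theorems.PercNearOneGluingNoHeavyLowerTailSahiCombTriWDipoleCert

/-!
# COMBO1 — the LEVEL-LOCAL matching behind `TRI_W(a)`: typed conjecture `ComboHall` and the reduction `ComboHall → TriWIneq`

Support file of the one-cut programme (crux `NoHeavyLowerTail`, stmt-CriticalPhenomena-4575; cell `prim-masterthm`, seat P5 gen 20; memo
`FROM-prim-masterthm-p5-g20-COMBO1.md` §1–§2, §8).  In the dipole form of `triW P F G` (`…SahiCombTriWDipoleCert`: demand tokens `D₁(v) = refl P ∩ F v` (tag 0),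
`D₂(v) = P ∩ refl (F vᶜ)` (tag 1), `D₃(v) = refl P ∩ refl (F vᶜ)` (tag 2); supply tokens `A(w) = B(w) = P ∩ F w` (tags 0, 1), `E(w) = refl P ∩ F wᶜ` (tag 2);
a token is `(tag, level, point)`) a MATCHING is an injection `φ` from demand tokens to supply tokens with `r ≤ φ r` in the product order (level `⊆`, point `⊆`);
any matching gives `0 ≤ triW P F G` for every monotone family of up-sets `G` (a demand inside the test family is sent to a supply inside it).  The gen-20 census found
that a matching with the following RIGID block structure exists on every configuration tested:

  `D₁ → A, B` at the SAME LEVEL only;   `D₃ → E` at the SAME LEVEL only;   `D₂ → B` and `D₃ → A` anywhere above;   no other block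

(COMBO1; exhaustive 0 failures on every cell with `#β + #γ ≤ 5` — (1,4): 1,273,608, (2,3): 151,620, (3,2): 45,486, (4,1): 22,743 configurations — and on (3,3): 156,567,080,
(4,2): 46,970,124, (5,1): 23,485,062 [kit j150009]; (2,4), (1,5): 150,000 random configurations each ((2,4) exhaustive = kit j149399, running at write);
m = 7: 180,000 random configurations over all six cells (+ kit j152345): 0 failures; every further
restriction FAILS; it is specific to the cylinder = `TriWIneq` case).  Unlike the tilt CERTIFICATES with this sparsity (refuted at `#β + #γ = 6`:
`…SahiCombTriWTiltCertFalse`, `…SahiCombTriWCertGenFalse`), the MATCHING statement is not refuted anywhere.  It says that in the Hall problem behind `TriWIneq` the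
demands `D₁` and the `E`-part of `D₃` never need to leave their level: only `D₂` and the `A`-overflow of `D₃` travel up the index cube (memo §2, §8 for the
two-commodity / induction-on-levels reading).

* `FiveUpSet.comboEdge r c` (Boolean) — the admissible edges (containment + the block/level rule above); `le_of_comboEdge`;
* **`FiveUpSet.ComboHall`** (`@[conjecture]`, an obligation of our theory, never a fact) — every configuration has an injective `comboEdge`-matching of its demand tokens;
* **`FiveUpSet.triWIneq_of_comboHall : ComboHall → TriWIneq`** — a matching is a 0/1 rank certificate (rows = distinct standard basis vectors), so
  `triWIneq_of_dipoleRankCert` applies.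
HONEST LABEL: a definition, a typed conjecture (census-backed as above, NOT proved) and its reduction; `TriWIneq` stays OPEN. [this work]
-/

namespace Summit.CriticalPhenomena.PercolationContinuityZ3.Theorems

namespace FiveUpSet

open Finset

variable {β γ : Type} [DecidableEq β] [Fintype β] [DecidableEq γ] [Fintype γ]

/-- The COMBO1 edge rule between a demand token `r` and a supply token `c`: containment in the product order, and the block structure
`D₁ → A, B` same level; `D₂ → B`; `D₃ → A`; `D₃ → E` same level. [this work] -/
def comboEdge (r c : Token β γ) : Bool :=
  (decide (r.2.1 ⊆ c.2.1) && decide (r.2.2 ⊆ c.2.2)) &&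
    ((decide (r.1 = 0) && (decide (c.1 = 0) || decide (c.1 = 1)) && decide (r.2.1 = c.2.1)) || (decide (r.1 = 1) && decide (c.1 = 1))
      || (decide (r.1 = 2) && decide (c.1 = 0)) || (decide (r.1 = 2) && decide (c.1 = 2) && decide (r.2.1 = c.2.1)))

omit [Fintype β] [Fintype γ] in
/-- A COMBO1 edge respects the product order. [this work] -/
theorem le_of_comboEdge {r c : Token β γ} (h : comboEdge r c = true) : r.2.1 ⊆ c.2.1 ∧ r.2.2 ⊆ c.2.2 := by
  unfold comboEdge at h
  simp only [Bool.and_eq_true, decide_eq_true_eq] at h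
  exact h.1

/-- **COMBO1 — the level-local matching** (CONJECTURE — an obligation of our theory, never a fact; memo §2).  For every finite index cube `Finset β`, fibre cube
`Finset γ`, up-set `P` and monotone family of up-sets `F` there is an injection `φ` of the demand tokens into the supply tokens of the dipole form along COMBO1
edges.  Census: exhaustive for `#β + #γ ≤ 5` and for the cells (3,3), (4,2), (5,1) of `#β + #γ = 6` (2.3·10⁸ configurations, 0 failures); (2,4), (1,5) and
`#β + #γ = 7` sampled (4.8·10⁵ configurations, 0 failures). OPEN. [this work] -/
@[conjecture] def ComboHall : Prop :=
  ∀ (β γ : Type) [DecidableEq β] [Fintype β] [DecidableEq γ] [Fintype γ]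
    (P : Finset (Finset γ)) (F : Finset β → Finset (Finset γ)),
    IsUpperSet (P : Set (Finset γ)) → (∀ x, IsUpperSet (F x : Set (Finset γ))) → Monotone F →
      ∃ φ : ↥(dipoleDem P F) → ↥(dipoleSup P F), Function.Injective φ ∧ ∀ r, comboEdge r.1 (φ r).1 = true

/-- **`ComboHall → TriWIneq`**: an injective containment-respecting matching is a dipole rank certificate — its 0/1 matrix has the distinct standard basis
vectors `e_{φ r}` as rows — so `triWIneq_of_dipoleRankCert` applies. [this work] -/
theorem triWIneq_of_comboHall (h : ComboHall) : TriWIneq := by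
  classical
  refine triWIneq_of_dipoleRankCert ?_
  intro β γ _ _ _ _ P F hP hF hFm
  obtain ⟨φ, hinj, hφ⟩ := h β γ P F hP hF hFm
  -- the 0/1 matrix of the matching (zero on non-demand rows)
  refine ⟨fun r c => if hr : r ∈ dipoleDem P F then (if (φ ⟨r, hr⟩).1 = c then 1 else 0) else 0, ?_, ?_⟩
  · intro r c hrc
    dsimp only at hrc
    by_cases hr : r ∈ dipoleDem P F
    · rw [dif_pos hr] at hrc
      by_cases hc : (φ ⟨r, hr⟩).1 = c
      · have key := le_of_comboEdge (hφ ⟨r, hr⟩)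
        rw [hc] at key
        exact key
      · exact absurd (if_neg hc) hrc
    · exact absurd (dif_neg hr) hrc
  · -- rows are the standard basis vectors `e_{φ r}`
    have heq : (fun r : ↥(dipoleDem P F) => fun c : ↥(dipoleSup P F) =>
        (if hr : r.1 ∈ dipoleDem P F then (if (φ ⟨r.1, hr⟩).1 = c.1 then (1 : ℚ) else 0) else 0))
        = fun r => (Pi.basisFun ℚ ↥(dipoleSup P F)) (φ r) := by
      funext r c
      rw [dif_pos r.2, Pi.basisFun_apply]
      by_cases hc : φ r = c
      · subst hc
        simp
      · have hc' : (φ r).1 ≠ c.1 := fun hh => hc (Subtype.ext hh)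
        rw [if_neg hc', Pi.single_eq_of_ne (Ne.symm hc)]
    rw [heq]
    exact (Pi.basisFun ℚ ↥(dipoleSup P F)).linearIndependent.comp φ hinj

end FiveUpSet

end Summit.CriticalPhenomena.PercolationContinuityZ3.Theorems
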